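/-
Copyright (c) 2026 the pub-hodgecm-mathlib formalisation cell (harness21).  Prover seat hodgecm-mathlib-LH4-p06 (g10), req620 Track A «(D-RAM) FOUR-FRAME» squad
F0∕P3c∕LH4; the (β₂) road (R-36), the MIX-HI WALL (β₂ WORDs #34∕#36; lead LH4-p13 (g10), MIX-HI DIGIT READING v2 5b3286ba): «THE PRODUCT BALANCE FROM THE FIBRES» — the
LATTICE HALF of the ‹PRODBAL-U› payer, hypothesis-first; helper lane on h413 = stmt-HodgeConjecture-24833 (count-neutral).  2026-09-05.
-/
import Summits.HodgeConjecture.HodgeConjecture.Theorems.F0P3cDyRamBeta2ConesOffRowUpperMixOfProdBalance   -- ★ p864724 (LH4-p13 (g10)): the CONSUMER `offRowUmix_of_prodBalance (hbal : ‹PRODBAL-U›)`; brings the whole ‹PRODBAL-U› vocabulary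
import Summits.HodgeConjecture.HodgeConjecture.Theorems.F0P3cDyRamConeCellCountSocketThree              -- ★ (LH4-p19 (g2)): §1 `ncard_eq_ncard_of_digit_fibration₂` (the abstract two-label count)
import Summits.HodgeConjecture.HodgeConjecture.Theorems.F0P3cDyRamSphereLabelSums                       -- ★ p864820 (LH4-p08 (g12)): §0 `normSign_mul_varpiF_pow_inv`, (B2) `sum_normSign_affine_filterValueSphere_eq_zero`
import Summits.HodgeConjecture.HodgeConjecture.Theorems.F0P3cDyRamDiagonalCellLabelDigits               -- ★ p862655 (LH4-p19): `sum_normSign_eq_card_sub_card`; brings ★ `normSign_eq_one_or`, ★ Lit `normSign_eq_of_near`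
import Summits.HodgeConjecture.HodgeConjecture.Theorems.F0P3cDyRamPieceRowsWildUnit0OfExports           -- ★ p857318: `v_two_lt_one_of_not_isUnit_two`
import HarnessLib

/-!
# Crux `H413`, line LH4 «(D-RAM) FOUR-FRAME» — STAGE-1b, row (2) of `f_{T₊}`, the (β₂) road (R-36), the MIX-HI WALL: «THE PRODUCT BALANCE FROM THE FIBRES» — on a cell `(j, b)`
# of the upper-line MIX band, ‹PRODBAL-U› cd24743f's conclusion `#{Λ ∈ cell ∣ NX Λ ∧ Pc Λ} = #{Λ ∈ cell ∣ NX Λ ∧ ¬ Pc Λ}` VERBATIM, FROM the digit letters (hypothesis-first)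

Cell `hodgecm-mathlib` (D-0151), FLOOR 0, crux item H413 = `stmt-HodgeConjecture-24833`, route of record `HCCMUnconditional`; squads F0∕P3c∕LH4 ∕ LH7; lane
`--supports stmt-HodgeConjecture-24833 --as helper` (count-neutral; pays NO tier-0 row).  THEOREMS ONLY (no `def`, no instance, no notation, no `sorry`, default heartbeats);
★-only imports; states NO law; ‹PRODBAL-U›, the MIX-HI band letters and (β₂) `stub_law_cleanSgn₂` stay HYPOTHESES of their consumers.
WHAT (MIX-HI lead LH4-p13 (g10) «= GO» 03:03:31Z, MIX-HI DIGIT READING v2 5b3286ba (LH-0)–(LH-4); β₂ sub-dealer LH4-p04 (g10)).  ‹PRODBAL-U› = binder `hbal` of ★ p864724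
`offRowUmix_of_prodBalance`: on every upper-line MIX cell (`1 ≤ b < j`, `m < 2b`, `j + m = jl + b`, `m_c + 2b ≤ 2m`, `m < m⋆ + b`, `IsOrd(lam)`) the UNWEIGHTED balance of the two
product classes on the exact-level digit, `NX`∕`Pc` = ★ p864672's `hNX`∕`hPc` right-hand sides.  THIS FILE is the LATTICE HALF of its payer in the W3 pattern of ★
`…Beta2ConesOffRowUpperRayWorker`: every geometric input is a NAMED binder in the shape its ★ ∕ ★-soon supplier produces; the file proves the COUNT.
* §1 `ncard_sep_eq_ncard_sep_of_digit_reads` — ABSTRACT (any `X`, UNWEIGHTED, `GEN` arbitrary, NO class letter): ★ `…CountSocketThree.ncard_eq_ncard_of_digit_fibration₂` at the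
  trivial class with two `X`-predicates `N`, `P` READ through the digit (`hRN : N Λ ↔ ND Ve`, `hRP : ND Ve → (P Λ ↔ PD Ve)` at `jE Ve = Vf x₀`), fibration letters `hI` (digit
  only), `hV`, `hLit`, `hND`∕`hPD` (constancy on `r`-balls, `PD` only ON `ND`), `hF` (class-free fibres), `hfin`, base balance ⟹ `#{(∃ x₀, GEN) ∧ N ∧ P} = #{(∃ x₀, GEN) ∧ N ∧ ¬P}`.
* §2 ONE-FIELD side: `valueSphere_iff_of_near` (the sphere `|α₁ + γ₁·V| = R` does not move under `|γ₁(Ve − V₀)| < R`), `normSign_affine_eq_of_near` (ON the sphere,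
  `|γ₁(Ve − V₀)| ≤ |ϖ|^{2ℓ}·|ϖ|^{2d−1}` ⟹ same `ω`: ★ p864820 §0 to the unit part + ★ Lit `normSign_eq_of_near`), `card_filter_eq_card_filter_not_of_sum_normSign_eq_zero`, and
  `baseBalance_of_fullSphere` — HEAD's `hbase` from ★ p864820 (B2) when the literal digits CONTAIN the value sphere (lower line ∕ deep-cancellation cells; MIX-HI lead 03:15:29Z:
  on U∕D-MIX the occurring digits are a class SUBSET of the sphere and `hbase` is paid by ★ F1 p864202's `hC` mechanism instead — hence `hbase` stays a binder of HEAD).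
* §3 HEAD `prodBalanceU_of_fibres (N)` — ‹PRODBAL-U›'s block and MIX cell line VERBATIM, THEN the lattice-half letters as named binders — digit `(Vf, n, Rd)` with (B2)'s ∕ ★ R0's
  class-system letters modulo `|ϖ|^n`; `LIT` (literal = depth ball ∧ occurrence class); `hgen` (generator independence of the digit at resolution `|ϖ|^n`: ★ LH7-p09's sharp lemma);
  (LH-2) `hV` (★ R1b-A frame); `hLit`; (LH-4) `hF` (★ p864078's shape, class-free: fibres over the literal digits have one size); the affine letters `α₁ γ₁ ℓ s₀` and (LH-3)
  `hrad : |γ₁|·|ϖ|^n ≤ |ϖ|^{2ℓ}·|ϖ|^{2d−1}` (the digit resolution reaches the conductor RELATIVE to the sphere — lead 03:04:40Z: `s − ℓ₀ + d − 1 ≥ 2d − 1` on the whole MIX band); the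
  reads `hNXd`, `hPcd` ((LH-0) ★ p864839 + (LH-1) ★ p864871 E-kernel = ★ p864917 `digitReads_of_presentation`, modulo the affine substitution); `hbase` in ★ R0 p864098's bytes
  (payer ★ F1-type on the sphere, LH4-p19's `SphereLabelDigitsOnSphere`, or §2 `baseBalance_of_fullSphere`) — THEN ‹PRODBAL-U›'s `ncard` equality VERBATIM.  INSIDE (no binder): the
  digit constancy of the sphere and of the sign from `hrad` (§2), finiteness from `_hfinLS`, the bookkeeping `{Λ ∈ levelSetDep ∣ …} = {Λ ∣ (∃ x₀, GEN6 Λ x₀) ∧ …}` (★ DEFS, definitional).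
WHAT IS NOT CLAIMED: any binder (digit, generator independence at `|ϖ|^n`, frame, fibres, reads, floor) — the digit payer's ∕ the E-kernel's ∕ (LH-3)'s; ‹PRODBAL-U› stays the
binder of ★ p864724 until the assembler `offRowUmix_holds` (MIX-HI lead) supplies them BY NAME.
HONEST LABEL.  Count-neutral bookkeeping; nothing printed is asserted; no census law is stated; ‹PRODBAL-U∕D∕L›, `core_holds`, (β₂) `stub_law_cleanSgn₂` UNPROVED; `HC_CM` is
proved only modulo the 7 printed citations (2 remaining named inputs: hLiu418 = `stmt-HodgeConjecture-24832`, h413 = `stmt-HodgeConjecture-24833`) until rung 0 closes.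
## References
* [Kottwitz1986BaseChangeUnits] R. E. Kottwitz, *Base change for unit elements of Hecke algebras*, Compositio Math. 60 (1986): §1 pp. 240–241 (cell-by-cell fixed-lattice counts).
* [LabesseLanglands1979] J.-P. Labesse, R. P. Langlands, *L-indistinguishability for SL(2)*, Canad. J. Math. 31 (1979): §2 (2.2) p. 9 (κ-signed counts).
* [Rogawski1990] J. D. Rogawski, *Automorphic Representations of Unitary Groups in Three Variables*, Ann. of Math. Stud. 123 (1990): §4.9 Prop. 4.9.1 (b) p. 55.
* [Serre1979] J.-P. Serre, *Local Fields*, GTM 67 (1979): Ch. V §3 Prop. 5, Cor. 2–3 pp. 84–86; Ch. XV §2 (the conductor; a non-trivial character sums to zero).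
* [Jacobowitz1962] R. Jacobowitz, *Hermitian forms over local fields*, Amer. J. Math. 84 (1962): §4 (duals, gluing, the glue unit).
-/

set_option autoImplicit false

noncomputable section

namespace Summit.HodgeConjecture.HodgeConjecture.Cruxes.H413.F0P3cDyRamMixBandProdBalanceOfFibres

open scoped Valued WithZero Matrix MatrixGroups Pointwise Classical
open WithZero Finset
open Literature.NumberTheory.Automorphic Literature.NumberTheory.Automorphic.HermitianLattice Literature.NumberTheory.Automorphic.UnitaryLatticeTree
open Literature.NumberTheory.Automorphic.UnitaryThreeFourFrame (IsRamifiedQuadraticDatum normSign)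
open Literature.NumberTheory.Rogawski1990
open Literature.NumberTheory.LocalFields.WildQuadraticDatum (normSign_eq_of_near)
open Summit.HodgeConjecture.HodgeConjecture.Cruxes.H413.F0P3cDyRamFourFramePieces
open Summit.HodgeConjecture.HodgeConjecture.Cruxes.H413.F0P3cDyRamFourFrameCensusDefs (LatticeInLevel LatticeNearTransvShell)
open Summit.HodgeConjecture.HodgeConjecture.Cruxes.H413.F0P3cDyRamStageOneBDefs (mcOfRecord)
open Summit.HodgeConjecture.HodgeConjecture.Cruxes.H413.F0P3cDyRamToricCensusDefs
open Summit.HodgeConjecture.HodgeConjecture.Cruxes.H413.F0P3cDyRamConeCellCountSocketThree (ncard_eq_ncard_of_digit_fibration₂)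
open Summit.HodgeConjecture.HodgeConjecture.Cruxes.H413.F0P3cDyRamSphereLabelSums (normSign_mul_varpiF_pow_inv sum_normSign_affine_filterValueSphere_eq_zero)
open Summit.HodgeConjecture.HodgeConjecture.Cruxes.H413.F0P3cDyRamDiagonalCellLabelDigits (sum_normSign_eq_card_sub_card)
open Summit.HodgeConjecture.HodgeConjecture.Cruxes.H413.F0P3cDyRamNormPairsIffFrames (normSign_eq_one_or)
open Summit.HodgeConjecture.HodgeConjecture.Cruxes.H413.F0P3cDyRamPieceRowsWildUnit0OfExports (v_two_lt_one_of_not_isUnit_two)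

variable {E M : Type} [Field E] [Valued E ℤᵐ⁰] [Field M] [Valued M ℤᵐ⁰] {σ : E →+* E}

/-! ## §1 The abstract count: two cell predicates read through a digit fibration, three-way (`N ∧ P` vs `N ∧ ¬P`), unweighted, class-free -/

/-- **THE BALANCE OF TWO DIGIT-READ PREDICATES ON A FIBRED FAMILY (abstract; class-free, unweighted form of ★ `…CountSocketThree` §1).**  Index type `X`, generator data `GEN`,
coordinate `Vf`, `jE` isometric, ONE resolution `r`, a class system `Rd` of the fixed unit ball modulo `r` (`hRd2`, `hRd3`), literal digits `LIT`, digit predicates `ND`, `PD`.  LETTERS: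
(hI) generators of one member have `r`-close coordinates; (hV) coordinates are fixed integral elements of `E`; (hLit) a class digit `r`-near a member is literal; (hND)(hPD) `ND`, and `PD`
ON `ND`, are constant on `r`-balls about class digits; (hF) the fibres `{Λ ∣ ∃ x₀, GEN Λ x₀ ∧ |Vf x₀ − jE y| ≤ r}` over literal class digits have one size; (hfin); two `X`-predicates
`N`, `P` with the READS (hRN) `N Λ ↔ ND Ve`, (hRP) `ND Ve → (P Λ ↔ PD Ve)` at `jE Ve = Vf x₀`; (hbase) `#((Rd.filter LIT).filter (ND ∧ PD)) = #((Rd.filter LIT).filter (ND ∧ ¬PD))`.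
THEN `#{Λ ∣ (∃ x₀, GEN Λ x₀) ∧ N Λ ∧ P Λ} = #{Λ ∣ (∃ x₀, GEN Λ x₀) ∧ N Λ ∧ ¬ P Λ}` (★ `ncard_eq_ncard_of_digit_fibration₂` at the trivial class, labels `ND ∧ PD`, `ND ∧ ¬PD`).
[cite: Kottwitz1986BaseChangeUnits, §1 pp. 240–241] [cite: LabesseLanglands1979, §2 (2.2) p. 9] -/
theorem ncard_sep_eq_ncard_sep_of_digit_reads {X : Type} (GEN : X → M → Prop) (Vf : M → M)
    (jE : E →+* M) (hjiso : ∀ a, Valued.v (jE a) = Valued.v a) (r : ℤᵐ⁰)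
    (Rd : Finset E) (hRd2 : ∀ V : E, σ V = V → Valued.v V ≤ 1 → ∃ V₀ ∈ Rd, Valued.v (V - V₀) ≤ r)
    (hRd3 : ∀ V ∈ Rd, ∀ V' ∈ Rd, Valued.v (V - V') ≤ r → V = V')
    (LIT ND PD : E → Prop) [DecidablePred LIT] [DecidablePred ND] [DecidablePred PD]
    (hI : ∀ (Λ : X) (x₀ x₀' : M), GEN Λ x₀ → GEN Λ x₀' → Valued.v (Vf x₀' - Vf x₀) ≤ r)
    (hV : ∀ (Λ : X) (x₀ : M), GEN Λ x₀ → ∃ Ve : E, jE Ve = Vf x₀ ∧ σ Ve = Ve ∧ Valued.v Ve ≤ 1)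
    (hLit : ∀ (Λ : X) (x₀ : M) (V₀ : E), GEN Λ x₀ → V₀ ∈ Rd → Valued.v (Vf x₀ - jE V₀) ≤ r → LIT V₀)
    (hND : ∀ Ve V₀ : E, σ Ve = Ve → Valued.v Ve ≤ 1 → V₀ ∈ Rd → Valued.v (Ve - V₀) ≤ r → (ND Ve ↔ ND V₀))
    (hPD : ∀ Ve V₀ : E, σ Ve = Ve → Valued.v Ve ≤ 1 → V₀ ∈ Rd → Valued.v (Ve - V₀) ≤ r → ND Ve → (PD Ve ↔ PD V₀))
    (hF : ∀ y ∈ Rd.filter LIT, ∀ y' ∈ Rd.filter LIT,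
      {Λ : X | ∃ x₀, GEN Λ x₀ ∧ Valued.v (Vf x₀ - jE y) ≤ r}.ncard = {Λ : X | ∃ x₀, GEN Λ x₀ ∧ Valued.v (Vf x₀ - jE y') ≤ r}.ncard)
    (hfin : {Λ : X | ∃ x₀, GEN Λ x₀}.Finite)
    (N P : X → Prop)
    (hRN : ∀ (Λ : X) (x₀ : M) (Ve : E), GEN Λ x₀ → jE Ve = Vf x₀ → (N Λ ↔ ND Ve))
    (hRP : ∀ (Λ : X) (x₀ : M) (Ve : E), GEN Λ x₀ → jE Ve = Vf x₀ → ND Ve → (P Λ ↔ PD Ve))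
    (hbase : ((Rd.filter LIT).filter fun V => ND V ∧ PD V).card = ((Rd.filter LIT).filter fun V => ND V ∧ ¬ PD V).card) :
    {Λ : X | (∃ x₀, GEN Λ x₀) ∧ N Λ ∧ P Λ}.ncard = {Λ : X | (∃ x₀, GEN Λ x₀) ∧ N Λ ∧ ¬ P Λ}.ncard := by
  -- the two sides as ★ fibration₂'s sets at the trivial class
  have hside : ∀ (Q : X → Prop) (φ' : E → Prop), (∀ (Λ : X) (x₀ : M) (Ve : E), GEN Λ x₀ → jE Ve = Vf x₀ → (Q Λ ↔ φ' Ve)) →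
      {Λ : X | (∃ x₀, GEN Λ x₀) ∧ Q Λ} = {Λ : X | ∃ x₀, GEN Λ x₀ ∧ ((fun _ : M => True) x₀ ↔ True) ∧ ∃ Ve : E, jE Ve = Vf x₀ ∧ φ' Ve} := by
    intro Q φ' hQ; ext Λ; simp only [Set.mem_setOf_eq, iff_self, true_and]; constructor
    · rintro ⟨⟨x₀, hG⟩, hQΛ⟩; obtain ⟨Ve, hjVe, -, -⟩ := hV Λ x₀ hG; exact ⟨x₀, hG, Ve, hjVe, (hQ Λ x₀ Ve hG hjVe).1 hQΛ⟩
    · rintro ⟨x₀, hG, Ve, hjVe, hφ⟩; exact ⟨⟨x₀, hG⟩, (hQ Λ x₀ Ve hG hjVe).2 hφ⟩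
  have hQ₁ : ∀ (Λ : X) (x₀ : M) (Ve : E), GEN Λ x₀ → jE Ve = Vf x₀ → ((N Λ ∧ P Λ) ↔ (ND Ve ∧ PD Ve)) := fun Λ x₀ Ve hG hj =>
    ⟨fun hh => ⟨(hRN Λ x₀ Ve hG hj).1 hh.1, (hRP Λ x₀ Ve hG hj ((hRN Λ x₀ Ve hG hj).1 hh.1)).1 hh.2⟩,
      fun hh => ⟨(hRN Λ x₀ Ve hG hj).2 hh.1, (hRP Λ x₀ Ve hG hj hh.1).2 hh.2⟩⟩
  have hQ₂ : ∀ (Λ : X) (x₀ : M) (Ve : E), GEN Λ x₀ → jE Ve = Vf x₀ → ((N Λ ∧ ¬ P Λ) ↔ (ND Ve ∧ ¬ PD Ve)) := fun Λ x₀ Ve hG hj =>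
    ⟨fun hh => ⟨(hRN Λ x₀ Ve hG hj).1 hh.1, fun h' => hh.2 ((hRP Λ x₀ Ve hG hj ((hRN Λ x₀ Ve hG hj).1 hh.1)).2 h')⟩,
      fun hh => ⟨(hRN Λ x₀ Ve hG hj).2 hh.1, fun h' => hh.2 ((hRP Λ x₀ Ve hG hj hh.1).1 h')⟩⟩
  rw [hside (fun Λ => N Λ ∧ P Λ) (fun V => ND V ∧ PD V) hQ₁, hside (fun Λ => N Λ ∧ ¬ P Λ) (fun V => ND V ∧ ¬ PD V) hQ₂]
  -- the class-free fibre letter in ★'s shape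
  have e : ∀ y₀ : E, {Λ : X | ∃ x₀, GEN Λ x₀ ∧ ((fun _ : M => True) x₀ ↔ True) ∧ Valued.v (Vf x₀ - jE y₀) ≤ r} =
      {Λ : X | ∃ x₀, GEN Λ x₀ ∧ Valued.v (Vf x₀ - jE y₀) ≤ r} := fun y₀ => by ext Λ; simp only [Set.mem_setOf_eq, iff_self, true_and]
  have hF' : ∀ y ∈ Rd.filter LIT, ∀ y' ∈ Rd.filter LIT,
      {Λ : X | ∃ x₀, GEN Λ x₀ ∧ ((fun _ : M => True) x₀ ↔ True) ∧ Valued.v (Vf x₀ - jE y) ≤ r}.ncard =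
        {Λ : X | ∃ x₀, GEN Λ x₀ ∧ ((fun _ : M => True) x₀ ↔ True) ∧ Valued.v (Vf x₀ - jE y') ≤ r}.ncard := fun y hy y' hy' => by
    rw [e, e]; exact hF y hy y' hy'
  exact ncard_eq_ncard_of_digit_fibration₂ (X := X) GEN (fun _ : M => True) Vf True jE hjiso r Rd hRd2 hRd3 LIT
    (fun V => ND V ∧ PD V) (fun V => ND V ∧ ¬ PD V) (fun Λ x₀ x₀' hG hG' => ⟨Iff.rfl, hI Λ x₀ x₀' hG hG'⟩) hV hLit
    (fun Ve V₀ h1 h2 h3 h4 => ⟨fun hh => ⟨(hND Ve V₀ h1 h2 h3 h4).1 hh.1, (hPD Ve V₀ h1 h2 h3 h4 hh.1).1 hh.2⟩,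
      fun hh => ⟨(hND Ve V₀ h1 h2 h3 h4).2 hh.1, (hPD Ve V₀ h1 h2 h3 h4 ((hND Ve V₀ h1 h2 h3 h4).2 hh.1)).2 hh.2⟩⟩)
    (fun Ve V₀ h1 h2 h3 h4 => ⟨fun hh => ⟨(hND Ve V₀ h1 h2 h3 h4).1 hh.1, fun h' => hh.2 ((hPD Ve V₀ h1 h2 h3 h4 hh.1).2 h')⟩,
      fun hh => ⟨(hND Ve V₀ h1 h2 h3 h4).2 hh.1, fun h' => hh.2 ((hPD Ve V₀ h1 h2 h3 h4 ((hND Ve V₀ h1 h2 h3 h4).2 hh.1)).1 h')⟩⟩)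
    hF' hfin hbase

/-! ## §2 The one-field side: the value sphere and its affine sign do not move under small perturbations of the digit; a vanishing sign sum is a balance -/

section OneField

variable {K : Type} [Field K] [Valued K ℤᵐ⁰]

/-- **THE VALUE SPHERE DOES NOT MOVE**: `|γ₁(Ve − V₀)| < R` ⟹ (`|α₁ + γ₁Ve| = R ↔ |α₁ + γ₁V₀| = R`). [cite: Serre1979, Ch. XV §2] -/
theorem valueSphere_iff_of_near {α₁ γ₁ Ve V₀ : K} {R : ℤᵐ⁰} (h : Valued.v (γ₁ * (Ve - V₀)) < R) :
    Valued.v (α₁ + γ₁ * Ve) = R ↔ Valued.v (α₁ + γ₁ * V₀) = R := by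
  have e1 : α₁ + γ₁ * V₀ = (α₁ + γ₁ * Ve) - γ₁ * (Ve - V₀) := by ring
  have e2 : α₁ + γ₁ * Ve = (α₁ + γ₁ * V₀) + γ₁ * (Ve - V₀) := by ring
  constructor
  · intro h1; rw [e1, Valuation.map_sub_eq_of_lt_left _ (by rw [h1]; exact h), h1]
  · intro h1; rw [e2, Valuation.map_add_eq_of_lt_left _ (by rw [h1]; exact h), h1]

/-- **THE AFFINE SIGN DOES NOT MOVE ON THE VALUE SPHERE**: at a complete ramified quadratic datum, for fixed `α₁, γ₁, Ve, V₀` with `|α₁ + γ₁Ve| = |ϖ|^{2ℓ}` and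
`|γ₁(Ve − V₀)| ≤ |ϖ|^{2ℓ}·|ϖ|^{2d−1}`: `ω(α₁ + γ₁V₀) = ω(α₁ + γ₁Ve)` — read both on the unit part `·ϖ_F^{−ℓ}` (★ p864820 §0, a norm factor) and apply ★ Lit `normSign_eq_of_near`
at the conductor digit `2d − 1`. [cite: Serre1979, Ch. V §3 Cor. 3 pp. 84–86; Ch. XV §2] -/
theorem normSign_affine_eq_of_near [CompleteSpace K] {σ : K →+* K} {ϖ : K} {d t : ℕ} (hD : IsRamifiedQuadraticDatum σ ϖ d t)
    {α₁ γ₁ Ve V₀ : K} (hσα₁ : σ α₁ = α₁) (hσγ₁ : σ γ₁ = γ₁) (hσVe : σ Ve = Ve) (hσV₀ : σ V₀ = V₀)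
    {ℓ : ℕ} (hsph : Valued.v (α₁ + γ₁ * Ve) = Valued.v ϖ ^ (2 * ℓ))
    (hnear : Valued.v (γ₁ * (Ve - V₀)) ≤ Valued.v ϖ ^ (2 * ℓ) * Valued.v ϖ ^ (2 * d - 1)) :
    normSign σ (α₁ + γ₁ * V₀) = normSign σ (α₁ + γ₁ * Ve) := by
  obtain ⟨hσ, hvσ, hϖ, -, -, -, -⟩ := id hD
  have hvϖ0 : Valued.v ϖ ≠ 0 := by rw [hϖ]; exact exp_ne_zero
  have hϖ0 : ϖ ≠ 0 := fun h0 => hvϖ0 (by rw [h0, map_zero])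
  have hP0 : Valued.v ϖ ^ (2 * ℓ) ≠ 0 := pow_ne_zero _ hvϖ0
  have hσπ : σ (((ϖ * σ ϖ) ^ ℓ)⁻¹) = ((ϖ * σ ϖ) ^ ℓ)⁻¹ := by rw [map_inv₀, map_pow, map_mul, hσ, mul_comm (σ ϖ) ϖ]
  have hvπ : Valued.v (((ϖ * σ ϖ) ^ ℓ)⁻¹) = (Valued.v ϖ ^ (2 * ℓ))⁻¹ := by rw [map_inv₀, map_pow, map_mul, hvσ, ← pow_two, ← pow_mul, mul_comm 2 ℓ]
  set g : K := (α₁ + γ₁ * Ve) * ((ϖ * σ ϖ) ^ ℓ)⁻¹ with hgdef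
  set g' : K := (α₁ + γ₁ * V₀) * ((ϖ * σ ϖ) ^ ℓ)⁻¹ with hg'def
  have hσg : σ g = g := by rw [hgdef, map_mul, map_add, map_mul, hσα₁, hσγ₁, hσVe, hσπ]
  have hσg' : σ g' = g' := by rw [hg'def, map_mul, map_add, map_mul, hσα₁, hσγ₁, hσV₀, hσπ]
  have hg1 : Valued.v g = 1 := by rw [hgdef, map_mul, hsph, hvπ, mul_inv_cancel₀ hP0]
  have hgg : Valued.v (g - g') ≤ Valued.v ϖ ^ (2 * d - 1) := by
    have e : g - g' = γ₁ * (Ve - V₀) * ((ϖ * σ ϖ) ^ ℓ)⁻¹ := by rw [hgdef, hg'def]; ring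
    rw [e, map_mul, hvπ]
    calc Valued.v (γ₁ * (Ve - V₀)) * (Valued.v ϖ ^ (2 * ℓ))⁻¹
        ≤ Valued.v ϖ ^ (2 * ℓ) * Valued.v ϖ ^ (2 * d - 1) * (Valued.v ϖ ^ (2 * ℓ))⁻¹ := mul_le_mul' hnear le_rfl
      _ = Valued.v ϖ ^ (2 * d - 1) := by rw [mul_comm (Valued.v ϖ ^ (2 * ℓ)), mul_assoc, mul_inv_cancel₀ hP0, mul_one]
  have key := normSign_eq_of_near hD hσg hσg' hg1 (n := 2 * d - 1) le_rfl hgg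
  rwa [hgdef, hg'def, normSign_mul_varpiF_pow_inv hϖ0, normSign_mul_varpiF_pow_inv hϖ0] at key

omit [Valued K ℤᵐ⁰] in
/-- **A VANISHING SIGN SUM IS A BALANCE**: for a finite `S`, any `φ`, and a sign token `s₀ ∈ {1, −1}`: `Σ_{V ∈ S} ω(φ V) = 0` ⟹ `#{V ∈ S ∣ ω(φ V) = s₀} = #{V ∈ S ∣ ω(φ V) ≠ s₀}`
(★ `sum_normSign_eq_card_sub_card` + ★ `normSign_eq_one_or`). [cite: Serre1979, Ch. XV §2] -/
theorem card_filter_eq_card_filter_not_of_sum_normSign_eq_zero (σ : K →+* K) (S : Finset K) (φ : K → K)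
    (hsum : ∑ V ∈ S, normSign σ (φ V) = 0) {s₀ : ℤ} (hs₀ : s₀ = 1 ∨ s₀ = -1) :
    (S.filter fun V => normSign σ (φ V) = s₀).card = (S.filter fun V => ¬ normSign σ (φ V) = s₀).card := by
  rw [sum_normSign_eq_card_sub_card σ S φ] at hsum
  have hneg : (S.filter fun V => ¬ normSign σ (φ V) = 1) = S.filter fun V => normSign σ (φ V) = -1 :=
    filter_congr fun V _ => by rcases normSign_eq_one_or σ (φ V) with h | h <;> rw [h] <;> norm_num
  have hpos : (S.filter fun V => ¬ normSign σ (φ V) = -1) = S.filter fun V => normSign σ (φ V) = 1 :=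
    filter_congr fun V _ => by rcases normSign_eq_one_or σ (φ V) with h | h <;> rw [h] <;> norm_num
  rcases hs₀ with rfl | rfl
  · rw [hneg]; omega
  · rw [hpos]; omega

/-- **THE BASE BALANCE WHEN THE WHOLE VALUE SPHERE OCCURS** ((B2) road; lower line ∕ deep-cancellation cells).  At a complete ramified quadratic datum with finite residue
field and `|2| < 1`: (B2)'s letters (`α₁, γ₁` fixed, `|α₁| ≤ |ϖ|^{2c} = |γ₁|`, floor `2d − 1 + 2ℓ ≤ 2c + n`, a class system `Rd` of the fixed unit ball modulo `|ϖ|^n`), literal digits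
`LIT` CONTAINING the value sphere (`hLITN`), a sign token `s₀ ∈ {1, −1}` ⟹ HEAD's `hbase`: `#(((Rd.filter LIT).filter sphere).filter (ω = s₀)) = #(((Rd.filter LIT).filter sphere).filter (ω ≠ s₀))`
(★ p864820 (B2) `sum_normSign_affine_filterValueSphere_eq_zero` + `card_filter_eq_card_filter_not_of_sum_normSign_eq_zero`). [cite: Serre1979, Ch. V §3 Cor. 3 pp. 84–86; Ch. XV §2] -/
theorem baseBalance_of_fullSphere [CompleteSpace K] [Finite 𝓀[K]] {σ : K →+* K} {ϖ : K} {d t : ℕ} (hD : IsRamifiedQuadraticDatum σ ϖ d t)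
    (h2v : Valued.v (2 : K) < 1) {α₁ γ₁ : K} (hσα₁ : σ α₁ = α₁) (hσγ₁ : σ γ₁ = γ₁) {c : ℕ} (hα₁ : Valued.v α₁ ≤ Valued.v ϖ ^ (2 * c))
    (hγ₁ : Valued.v γ₁ = Valued.v ϖ ^ (2 * c)) {ℓ n : ℕ} (hfloor : 2 * d - 1 + 2 * ℓ ≤ 2 * c + n)
    (Rd : Finset K) (hRd1 : ∀ V ∈ Rd, σ V = V ∧ Valued.v V ≤ 1) (hRd2 : ∀ V : K, σ V = V → Valued.v V ≤ 1 → ∃ V₀ ∈ Rd, Valued.v (V - V₀) ≤ Valued.v ϖ ^ n)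
    (hRd3 : ∀ V ∈ Rd, ∀ V' ∈ Rd, Valued.v (V - V') ≤ Valued.v ϖ ^ n → V = V') (LIT : K → Prop) [DecidablePred LIT]
    (hLITN : ∀ V ∈ Rd, Valued.v (α₁ + γ₁ * V) = Valued.v ϖ ^ (2 * ℓ) → LIT V) {s₀ : ℤ} (hs₀ : s₀ = 1 ∨ s₀ = -1) :
    (((Rd.filter LIT).filter fun V => Valued.v (α₁ + γ₁ * V) = Valued.v ϖ ^ (2 * ℓ)).filter fun V => normSign σ (α₁ + γ₁ * V) = s₀).card =
      (((Rd.filter LIT).filter fun V => Valued.v (α₁ + γ₁ * V) = Valued.v ϖ ^ (2 * ℓ)).filter fun V => ¬ normSign σ (α₁ + γ₁ * V) = s₀).card := by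
  have hdress : (Rd.filter LIT).filter (fun V => Valued.v (α₁ + γ₁ * V) = Valued.v ϖ ^ (2 * ℓ)) = Rd.filter fun V => Valued.v (α₁ + γ₁ * V) = Valued.v ϖ ^ (2 * ℓ) := by
    ext V; simp only [Finset.mem_filter]
    exact ⟨fun hh => ⟨hh.1.1, hh.2⟩, fun hh => ⟨⟨hh.1, hLITN V hh.1 hh.2⟩, hh.2⟩⟩
  rw [hdress]
  exact card_filter_eq_card_filter_not_of_sum_normSign_eq_zero σ _ (fun V => α₁ + γ₁ * V)
    (sum_normSign_affine_filterValueSphere_eq_zero hD h2v hσα₁ hσγ₁ hα₁ hγ₁ hfloor Rd hRd1 hRd2 hRd3) hs₀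

end OneField

/-! ## §3 HEAD — ‹PRODBAL-U› from the lattice-half letters -/

/-- **HEAD — «THE PRODUCT BALANCE FROM THE FIBRES» (the LATTICE HALF of the ‹PRODBAL-U› payer, hypothesis-first).**  Binders: `N`; ‹PRODBAL-U› cd24743f's block (= ★ p864724
`offRowUmix_of_prodBalance`'s `hbal` lines) and its upper-line MIX cell line `1 ≤ b < j`, `m < 2b`, `j + m = jl + b`, `m_c + 2b ≤ 2m`, `m < m⋆ + b`, `IsOrd(lam)` VERBATIM; THEN the
lattice-half letters (module docstring §3: digit `Vf n Rd` + class-system letters, `LIT`, `hgen`, `hV`, `hLit`, `hF`, affine letters `α₁ γ₁ ℓ s₀`, `hrad`, reads `hNXd` ∕ `hPcd`, `hbase`);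
THEN ‹PRODBAL-U›'s conclusion VERBATIM: `{Λ ∈ levelSetDep(j, b; μ) ∣ NX Λ ∧ Pc Λ}.ncard = {Λ ∈ levelSetDep(j, b; μ) ∣ NX Λ ∧ ¬ Pc Λ}.ncard`.  Proof: §1 at `GEN :=` the six membership
clauses of `levelSetDep`, `ND :=` the value sphere, `PD :=` the affine sign `= s₀`, digit constancy by §2 from `hrad`.
[cite: Kottwitz1986BaseChangeUnits, §1 pp. 240–241] [cite: LabesseLanglands1979, §2 (2.2) p. 9] [cite: Rogawski1990, §4.9 Prop. 4.9.1 (b) p. 55] [cite: Serre1979, Ch. XV §2] -/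
theorem prodBalanceU_of_fibres (N : ℕ → ℕ → ℕ → ℕ) :
    ∀ (E M : Type) [Field E] [Valued E ℤᵐ⁰] [CompleteSpace E] [IsDiscreteValuationRing 𝒪[E]] [Finite 𝓀[E]]
      [Field M] [Valued M ℤᵐ⁰] [CompleteSpace M] [IsDiscreteValuationRing 𝒪[M]] [Finite 𝓀[M]]
      (σ : E →+* E) (ϖ : E) (d tE : ℕ) (_hD : IsRamifiedQuadraticDatum σ ϖ d tE) (_hσσ : ∀ a, σ (σ a) = a) (_h2 : ¬ IsUnit (2 : 𝒪[E]))
      (jE : E →+* M) (ρ Θ : M →+* M) (α lam : M)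
      (_hρρ : ∀ z, ρ (ρ z) = z) (_hvρ : ∀ z, Valued.v (ρ z) = Valued.v z) (_hρj : ∀ a, ρ (jE a) = jE a)
      (_hjv : ∀ a, Valued.v (jE a) ≤ 1 ↔ Valued.v a ≤ 1) (_hjfix : ∀ z : M, ρ z = z ↔ ∃ a, jE a = z) (_hΘj : ∀ a, Θ (jE a) = jE (σ a))
      (_hΘΘ : ∀ z, Θ (Θ z) = z) (_hΘρ : ∀ z, Θ (ρ z) = ρ (Θ z)) (_hvΘ : ∀ z, Valued.v (Θ z) = Valued.v z)
      (_hα : ρ α ≠ α) (_hα1 : Valued.v α ≤ 1) (_hint : ∀ z : M, Valued.v z ≤ 1 → Valued.v ((z - ρ z) / (α - ρ α)) ≤ 1)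
      (_hΘlam : Θ lam * lam = 1) (_hvlam : Valued.v lam = 1) (_hbasis : ∀ z : M, ∃! pq : E × E, z = jE pq.1 + jE pq.2 * lam)
      (_hU : Valued.v (α - ρ α) = 1) (_hτ : Valued.v (α - Θ α) < 1)
      (_hσres : ∀ z : M, ρ z = z → Valued.v z ≤ 1 → Valued.v (Θ z - z) < 1) (_hres : ∀ z : M, Valued.v z ≤ 1 → Valued.v (z - Θ z) < 1)
      (_hΘne : ∃ x : M, Θ x ≠ x) (_hDM : IsRamifiedQuadraticDatum Θ (jE ϖ) d tE) (_hjiso : ∀ a, Valued.v (jE a) = Valued.v a)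
      (_hq : Nat.card 𝓀[M] = Nat.card 𝓀[E] ^ 2) (_hjpow : ∀ (t : E) (n : ℤ), Valued.v (jE t) = Valued.v (jE ϖ) ^ n ↔ Valued.v t = Valued.v ϖ ^ n)
      (_hEval : ∀ c : M, ρ c = c → c ≠ 0 → Valued.v c ≤ 1 → ∃ n : ℕ, Valued.v c = Valued.v (jE ϖ) ^ n)
      (_hϖmax : ∀ t : M, ρ t = t → Valued.v t < 1 → Valued.v t ≤ Valued.v (jE ϖ))
      (γ₂ : GL (Fin 2) E) (u : GL (Fin 1) E)
      (_hdet : (γ₂ : Matrix (Fin 2) (Fin 2) E).det * σ (γ₂ : Matrix (Fin 2) (Fin 2) E).det = 1)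
      (_htr : (γ₂ : Matrix (Fin 2) (Fin 2) E).trace = (γ₂ : Matrix (Fin 2) (Fin 2) E).det * σ (γ₂ : Matrix (Fin 2) (Fin 2) E).trace)
      (_hirr : ∀ x : E, x * x - (γ₂ : Matrix (Fin 2) (Fin 2) E).trace * x + (γ₂ : Matrix (Fin 2) (Fin 2) E).det ≠ 0)
      (_hlam2 : lam * lam = jE (γ₂ : Matrix (Fin 2) (Fin 2) E).trace * lam - jE (γ₂ : Matrix (Fin 2) (Fin 2) E).det)
      (_hρlam : ρ lam = jE (γ₂ : Matrix (Fin 2) (Fin 2) E).trace - lam) (m jl : ℕ) (_hm : Valued.v (lam - jE ((u : Matrix (Fin 1) (Fin 1) E) 0 0)) = WithZero.exp (-(m : ℤ)))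
      (_hjl : Valued.v ((lam - jE ((u : Matrix (Fin 1) (Fin 1) E) 0 0)) - ρ (lam - jE ((u : Matrix (Fin 1) (Fin 1) E) 0 0))) = WithZero.exp (-(jl : ℤ)))
      (_hs : Valued.v ((γ₂ : Matrix (Fin 2) (Fin 2) E).trace - 2) * Valued.v (ϖ ^ (d % 2)) ≤ Valued.v (ϖ ^ mcOfRecord d))
      (_hp : Valued.v ((γ₂ : Matrix (Fin 2) (Fin 2) E).det - (γ₂ : Matrix (Fin 2) (Fin 2) E).trace + 1) ≤ Valued.v (ϖ ^ mcOfRecord d))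
      (_hNm : N d tE (Nat.card 𝓀[E]) ≤ m) (_hu1N : Valued.v (((u : Matrix (Fin 1) (Fin 1) E) 0 0) - 1) ≤ Valued.v (ϖ ^ N d tE (Nat.card 𝓀[E]))) (_hlam1 : Valued.v (lam - 1) ≤ Valued.v (jE ϖ ^ N d tE (Nat.card 𝓀[E])))
      (_hu : Valued.v ((u : Matrix (Fin 1) (Fin 1) E) 0 0) = 1) (_hum : Valued.v (((u : Matrix (Fin 1) (Fin 1) E) 0 0) - 1) ≤ Valued.v (ϖ ^ mstarOfRecord d))
      (H₂ : Matrix (Fin 2) (Fin 2) E) (hW : E) (_hH₂ : IsUnit H₂.det) (_hH₂σ : (H₂.map σ)ᵀ = H₂) (_hhW : Valued.v hW = 1) (_hhWσ : σ hW = hW)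
      (P₁ : GL (Fin 3) E) (_hA : formCongr σ P₁ ((StdForm.antidiagonal 3).over E) = (!![H₂ 0 0, 0, H₂ 0 1; 0, hW, 0; H₂ 1 0, 0, H₂ 1 1] : Matrix (Fin 3) (Fin 3) E))
      (_hΓ : P₁ * endoGL (γ₂, u) * P₁⁻¹ ∈ unitaryGroupOfForm σ ((StdForm.antidiagonal 3).over E))
      (φ : (Fin 2 → E) →+ M) (h : M) (_hφs : ∀ (c : E) (x : Fin 2 → E), φ (c • x) = jE c * φ x) (_hφi : Function.Injective φ) (_hφo : Function.Surjective φ)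
      (_hφγ : ∀ x, φ ((γ₂ : Matrix (Fin 2) (Fin 2) E).mulVec x) = lam * φ x)
      (_hform : ∀ x y, jE (pairing σ H₂ x y) = h * Θ (φ x) * φ y + ρ (h * Θ (φ x) * φ y)) (_hΘh : Θ h = h) (_hh : h ≠ 0)
      (J R : ℕ) (f : ℕ → ℕ → AddSubgroup M → ℕ)
      (_hfinF : {L₃ : Submodule 𝒪[E] (Fin 3 → E) | IsSelfDualLattice σ ϖ (!![H₂ 0 0, 0, H₂ 0 1; 0, hW, 0; H₂ 1 0, 0, H₂ 1 1] : Matrix (Fin 3) (Fin 3) E) L₃ ∧ mapGL (endoGL (γ₂, u)) L₃ = L₃}.Finite)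
      (_hR : ∀ L₃ : Submodule 𝒪[E] (Fin 3 → E), IsSelfDualLattice σ ϖ (!![H₂ 0 0, 0, H₂ 0 1; 0, hW, 0; H₂ 1 0, 0, H₂ 1 1] : Matrix (Fin 3) (Fin 3) E) L₃ →
        mapGL (endoGL (γ₂, u)) L₃ = L₃ → ∀ b : ℕ, (∀ c : E, (Pi.single 1 c : Fin 3 → E) ∈ L₃ ↔ Valued.v c ≤ Valued.v ϖ ^ b) → b ≤ R)
      (_hJ : ¬ IsOrd ρ α (jE ϖ ^ (J + 1)) lam) (_hfinLS : ∀ j a, (levelSet ρ Θ α (jE ϖ) h j a).Finite)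
      (_hf : ∀ (b j : ℕ) (Λ : AddSubgroup M) (x₀ : M) (r : E), 1 ≤ b → x₀ ≠ 0 → (∀ x, x ∈ Λ ↔ ∃ z, IsOrd ρ α (jE ϖ ^ j) z ∧ x = x₀ * z) →
        IsOrd ρ α (jE ϖ ^ j) (dualGen ρ Θ α (jE ϖ ^ j) h x₀) → ¬ IsOrd ρ α (jE ϖ ^ j) (dualGen ρ Θ α (jE ϖ ^ j) h x₀ / jE ϖ) → Valued.v (dualGen ρ Θ α (jE ϖ ^ j) h x₀) = Valued.v (jE ϖ) ^ b →
        (∀ b', (∀ x ∈ Λ, Valued.v (h * Θ x * b' + ρ (h * Θ x * b')) ≤ 1) → (lam - jE ((u : Matrix (Fin 1) (Fin 1) E) 0 0)) * b' ∈ Λ) → IsOrd ρ α (jE ϖ ^ j) lam →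
        jE r = glueUnit ρ Θ α (jE ϖ ^ j) h (jE ϖ) (jE hW) x₀ b →
        f b j Λ = Nat.card {x : 𝒪[E] ⧸ 𝓂[E] ^ (2 * b) // ∃ u' : 𝒪[E], Ideal.Quotient.mk (𝓂[E] ^ (2 * b)) u' = x ∧ Valued.v ((u' : E) * σ u' - r) ≤ Valued.v (ϖ ^ (2 * b))}),
      ∀ j b : ℕ, 1 ≤ b → b < j → m < 2 * b → j + m = jl + b → mcOfRecord d + 2 * b ≤ 2 * m → m < mstarOfRecord d + b → IsOrd ρ α (jE ϖ ^ j) lam →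
              -- ══ the LATTICE-HALF LETTERS (hypothesis-first; MIX-HI DIGIT READING v2 (LH-0)–(LH-4)) ══
              ∀ (Vf : M → M) (n : ℕ) (Rd : Finset E),
                (∀ V ∈ Rd, σ V = V ∧ Valued.v V ≤ 1) →
                (∀ V : E, σ V = V → Valued.v V ≤ 1 → ∃ V₀ ∈ Rd, Valued.v (V - V₀) ≤ Valued.v ϖ ^ n) →
                (∀ V ∈ Rd, ∀ V' ∈ Rd, Valued.v (V - V') ≤ Valued.v ϖ ^ n → V = V') →
              ∀ (LIT : E → Prop),
                (∀ (Λ : AddSubgroup M) (x₀ x₀' : M),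
                  (x₀ ≠ 0 ∧ (∀ x, x ∈ Λ ↔ ∃ ζ, IsOrd ρ α (jE ϖ ^ j) ζ ∧ x = x₀ * ζ) ∧ IsOrd ρ α (jE ϖ ^ j) (dualGen ρ Θ α (jE ϖ ^ j) h x₀) ∧
                  ¬ IsOrd ρ α (jE ϖ ^ j) (dualGen ρ Θ α (jE ϖ ^ j) h x₀ / jE ϖ) ∧ Valued.v (dualGen ρ Θ α (jE ϖ ^ j) h x₀) = Valued.v (jE ϖ) ^ b ∧
                  (∀ b', (∀ x ∈ Λ, Valued.v (h * Θ x * b' + ρ (h * Θ x * b')) ≤ 1) → (lam - jE ((u : Matrix (Fin 1) (Fin 1) E) 0 0)) * b' ∈ Λ)) →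
                  (x₀' ≠ 0 ∧ (∀ x, x ∈ Λ ↔ ∃ ζ, IsOrd ρ α (jE ϖ ^ j) ζ ∧ x = x₀' * ζ) ∧ IsOrd ρ α (jE ϖ ^ j) (dualGen ρ Θ α (jE ϖ ^ j) h x₀') ∧
                  ¬ IsOrd ρ α (jE ϖ ^ j) (dualGen ρ Θ α (jE ϖ ^ j) h x₀' / jE ϖ) ∧ Valued.v (dualGen ρ Θ α (jE ϖ ^ j) h x₀') = Valued.v (jE ϖ) ^ b ∧
                  (∀ b', (∀ x ∈ Λ, Valued.v (h * Θ x * b' + ρ (h * Θ x * b')) ≤ 1) → (lam - jE ((u : Matrix (Fin 1) (Fin 1) E) 0 0)) * b' ∈ Λ)) →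
                  Valued.v (Vf x₀' - Vf x₀) ≤ Valued.v ϖ ^ n) →
                (∀ (Λ : AddSubgroup M) (x₀ : M),
                  (x₀ ≠ 0 ∧ (∀ x, x ∈ Λ ↔ ∃ ζ, IsOrd ρ α (jE ϖ ^ j) ζ ∧ x = x₀ * ζ) ∧ IsOrd ρ α (jE ϖ ^ j) (dualGen ρ Θ α (jE ϖ ^ j) h x₀) ∧
                  ¬ IsOrd ρ α (jE ϖ ^ j) (dualGen ρ Θ α (jE ϖ ^ j) h x₀ / jE ϖ) ∧ Valued.v (dualGen ρ Θ α (jE ϖ ^ j) h x₀) = Valued.v (jE ϖ) ^ b ∧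
                  (∀ b', (∀ x ∈ Λ, Valued.v (h * Θ x * b' + ρ (h * Θ x * b')) ≤ 1) → (lam - jE ((u : Matrix (Fin 1) (Fin 1) E) 0 0)) * b' ∈ Λ)) →
                  ∃ Ve : E, jE Ve = Vf x₀ ∧ σ Ve = Ve ∧ Valued.v Ve ≤ 1) →
                (∀ (Λ : AddSubgroup M) (x₀ : M) (V₀ : E),
                  (x₀ ≠ 0 ∧ (∀ x, x ∈ Λ ↔ ∃ ζ, IsOrd ρ α (jE ϖ ^ j) ζ ∧ x = x₀ * ζ) ∧ IsOrd ρ α (jE ϖ ^ j) (dualGen ρ Θ α (jE ϖ ^ j) h x₀) ∧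
                  ¬ IsOrd ρ α (jE ϖ ^ j) (dualGen ρ Θ α (jE ϖ ^ j) h x₀ / jE ϖ) ∧ Valued.v (dualGen ρ Θ α (jE ϖ ^ j) h x₀) = Valued.v (jE ϖ) ^ b ∧
                  (∀ b', (∀ x ∈ Λ, Valued.v (h * Θ x * b' + ρ (h * Θ x * b')) ≤ 1) → (lam - jE ((u : Matrix (Fin 1) (Fin 1) E) 0 0)) * b' ∈ Λ)) →
                  V₀ ∈ Rd → Valued.v (Vf x₀ - jE V₀) ≤ Valued.v ϖ ^ n → LIT V₀) →
                (∀ y ∈ Rd.filter LIT, ∀ y' ∈ Rd.filter LIT,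
                  {Λ : AddSubgroup M | ∃ x₀ : M,
                    (x₀ ≠ 0 ∧ (∀ x, x ∈ Λ ↔ ∃ ζ, IsOrd ρ α (jE ϖ ^ j) ζ ∧ x = x₀ * ζ) ∧ IsOrd ρ α (jE ϖ ^ j) (dualGen ρ Θ α (jE ϖ ^ j) h x₀) ∧
                  ¬ IsOrd ρ α (jE ϖ ^ j) (dualGen ρ Θ α (jE ϖ ^ j) h x₀ / jE ϖ) ∧ Valued.v (dualGen ρ Θ α (jE ϖ ^ j) h x₀) = Valued.v (jE ϖ) ^ b ∧
                  (∀ b', (∀ x ∈ Λ, Valued.v (h * Θ x * b' + ρ (h * Θ x * b')) ≤ 1) → (lam - jE ((u : Matrix (Fin 1) (Fin 1) E) 0 0)) * b' ∈ Λ)) ∧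
                    Valued.v (Vf x₀ - jE y) ≤ Valued.v ϖ ^ n}.ncard =
                  {Λ : AddSubgroup M | ∃ x₀ : M,
                    (x₀ ≠ 0 ∧ (∀ x, x ∈ Λ ↔ ∃ ζ, IsOrd ρ α (jE ϖ ^ j) ζ ∧ x = x₀ * ζ) ∧ IsOrd ρ α (jE ϖ ^ j) (dualGen ρ Θ α (jE ϖ ^ j) h x₀) ∧
                  ¬ IsOrd ρ α (jE ϖ ^ j) (dualGen ρ Θ α (jE ϖ ^ j) h x₀ / jE ϖ) ∧ Valued.v (dualGen ρ Θ α (jE ϖ ^ j) h x₀) = Valued.v (jE ϖ) ^ b ∧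
                  (∀ b', (∀ x ∈ Λ, Valued.v (h * Θ x * b' + ρ (h * Θ x * b')) ≤ 1) → (lam - jE ((u : Matrix (Fin 1) (Fin 1) E) 0 0)) * b' ∈ Λ)) ∧
                    Valued.v (Vf x₀ - jE y') ≤ Valued.v ϖ ^ n}.ncard) →
              -- the affine letters of the value sphere `|α₁ + γ₁·V| = |ϖ|^{2ℓ}` and its sign token; (LH-3) `hrad`: the digit resolution reaches the conductor RELATIVE to the sphere
            ∀ (α₁ γ₁ : E) (ℓ : ℕ) (s₀ : ℤ), σ α₁ = α₁ → σ γ₁ = γ₁ → Valued.v γ₁ * Valued.v ϖ ^ n ≤ Valued.v ϖ ^ (2 * ℓ) * Valued.v ϖ ^ (2 * d - 1) →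
            -- (LH-0)+(LH-1)+(LH-2) the reads at any presentation: `hNXd` (exact-level digit = value sphere), `hPcd` (ON the sphere, product class = affine sign)
              (∀ (Λ : AddSubgroup M) (x₀ : M) (Ve : E),
                (x₀ ≠ 0 ∧ (∀ x, x ∈ Λ ↔ ∃ ζ, IsOrd ρ α (jE ϖ ^ j) ζ ∧ x = x₀ * ζ) ∧ IsOrd ρ α (jE ϖ ^ j) (dualGen ρ Θ α (jE ϖ ^ j) h x₀) ∧
                  ¬ IsOrd ρ α (jE ϖ ^ j) (dualGen ρ Θ α (jE ϖ ^ j) h x₀ / jE ϖ) ∧ Valued.v (dualGen ρ Θ α (jE ϖ ^ j) h x₀) = Valued.v (jE ϖ) ^ b ∧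
                  (∀ b', (∀ x ∈ Λ, Valued.v (h * Θ x * b' + ρ (h * Θ x * b')) ≤ 1) → (lam - jE ((u : Matrix (Fin 1) (Fin 1) E) 0 0)) * b' ∈ Λ)) →
                jE Ve = Vf x₀ →
                ((∃ (x₀ : M) (e₀ : E), x₀ ≠ 0 ∧ (∀ x, x ∈ Λ ↔ ∃ ζ, IsOrd ρ α (jE ϖ ^ j) ζ ∧ x = x₀ * ζ) ∧
                     IsOrd ρ α (jE ϖ ^ j) (dualGen ρ Θ α (jE ϖ ^ j) h x₀) ∧ ¬ IsOrd ρ α (jE ϖ ^ j) (dualGen ρ Θ α (jE ϖ ^ j) h x₀ / jE ϖ) ∧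
                     Valued.v (dualGen ρ Θ α (jE ϖ ^ j) h x₀) = Valued.v (jE ϖ) ^ b ∧
                     jE e₀ = (lam - jE ((u : Matrix (Fin 1) (Fin 1) E) 0 0)) / (jE ϖ ^ j * (α - ρ α) * Θ (dualGen ρ Θ α (jE ϖ ^ j) h x₀)) +
                       ρ ((lam - jE ((u : Matrix (Fin 1) (Fin 1) E) 0 0)) / (jE ϖ ^ j * (α - ρ α) * Θ (dualGen ρ Θ α (jE ϖ ^ j) h x₀))) ∧
                     Valued.v e₀ = Valued.v ϖ ^ (d % 2)) ↔
                  Valued.v (α₁ + γ₁ * Ve) = Valued.v ϖ ^ (2 * ℓ))) →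
              (∀ (Λ : AddSubgroup M) (x₀ : M) (Ve : E),
                (x₀ ≠ 0 ∧ (∀ x, x ∈ Λ ↔ ∃ ζ, IsOrd ρ α (jE ϖ ^ j) ζ ∧ x = x₀ * ζ) ∧ IsOrd ρ α (jE ϖ ^ j) (dualGen ρ Θ α (jE ϖ ^ j) h x₀) ∧
                  ¬ IsOrd ρ α (jE ϖ ^ j) (dualGen ρ Θ α (jE ϖ ^ j) h x₀ / jE ϖ) ∧ Valued.v (dualGen ρ Θ α (jE ϖ ^ j) h x₀) = Valued.v (jE ϖ) ^ b ∧
                  (∀ b', (∀ x ∈ Λ, Valued.v (h * Θ x * b' + ρ (h * Θ x * b')) ≤ 1) → (lam - jE ((u : Matrix (Fin 1) (Fin 1) E) 0 0)) * b' ∈ Λ)) →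
                jE Ve = Vf x₀ → Valued.v (α₁ + γ₁ * Ve) = Valued.v ϖ ^ (2 * ℓ) →
                ((∃ (x₀ : M) (r e₀ e' : E), x₀ ≠ 0 ∧ (∀ x, x ∈ Λ ↔ ∃ ζ, IsOrd ρ α (jE ϖ ^ j) ζ ∧ x = x₀ * ζ) ∧
                     IsOrd ρ α (jE ϖ ^ j) (dualGen ρ Θ α (jE ϖ ^ j) h x₀) ∧ ¬ IsOrd ρ α (jE ϖ ^ j) (dualGen ρ Θ α (jE ϖ ^ j) h x₀ / jE ϖ) ∧
                     Valued.v (dualGen ρ Θ α (jE ϖ ^ j) h x₀) = Valued.v (jE ϖ) ^ b ∧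
                     σ r = r ∧ Valued.v r = 1 ∧ jE r = glueUnit ρ Θ α (jE ϖ ^ j) h (jE ϖ) (jE hW) x₀ b ∧
                     jE e₀ = (lam - jE ((u : Matrix (Fin 1) (Fin 1) E) 0 0)) / (jE ϖ ^ j * (α - ρ α) * Θ (dualGen ρ Θ α (jE ϖ ^ j) h x₀)) +
                       ρ ((lam - jE ((u : Matrix (Fin 1) (Fin 1) E) 0 0)) / (jE ϖ ^ j * (α - ρ α) * Θ (dualGen ρ Θ α (jE ϖ ^ j) h x₀))) ∧
                     σ e' = e' ∧ Valued.v e' = 1 ∧ Valued.v (e₀ - e' * ((ϖ - σ ϖ) * ((ϖ * σ ϖ) ^ ((d - d % 2) / 2))⁻¹)) ≤ Valued.v ϖ ^ mstarOfRecord d ∧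
                     ∃ c : E, c * σ c = r * e') ↔
                  normSign σ (α₁ + γ₁ * Ve) = s₀)) →
            -- `hbase`: the digit balance on the literal part of the value sphere (★ `…ConeCellCountSocketDep` R0's bytes; payer ★ F1-type ∕ §2 `baseBalance_of_fullSphere`)
              (((Rd.filter LIT).filter fun V => Valued.v (α₁ + γ₁ * V) = Valued.v ϖ ^ (2 * ℓ)).filter fun V => normSign σ (α₁ + γ₁ * V) = s₀).card =
                (((Rd.filter LIT).filter fun V => Valued.v (α₁ + γ₁ * V) = Valued.v ϖ ^ (2 * ℓ)).filter fun V => ¬ normSign σ (α₁ + γ₁ * V) = s₀).card →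
              {Λ ∈ levelSetDep ρ Θ α (jE ϖ) h j b (lam - jE ((u : Matrix (Fin 1) (Fin 1) E) 0 0)) |
                  (∃ (x₀ : M) (e₀ : E), x₀ ≠ 0 ∧ (∀ x, x ∈ Λ ↔ ∃ ζ, IsOrd ρ α (jE ϖ ^ j) ζ ∧ x = x₀ * ζ) ∧
                     IsOrd ρ α (jE ϖ ^ j) (dualGen ρ Θ α (jE ϖ ^ j) h x₀) ∧ ¬ IsOrd ρ α (jE ϖ ^ j) (dualGen ρ Θ α (jE ϖ ^ j) h x₀ / jE ϖ) ∧
                     Valued.v (dualGen ρ Θ α (jE ϖ ^ j) h x₀) = Valued.v (jE ϖ) ^ b ∧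
                     jE e₀ = (lam - jE ((u : Matrix (Fin 1) (Fin 1) E) 0 0)) / (jE ϖ ^ j * (α - ρ α) * Θ (dualGen ρ Θ α (jE ϖ ^ j) h x₀)) +
                       ρ ((lam - jE ((u : Matrix (Fin 1) (Fin 1) E) 0 0)) / (jE ϖ ^ j * (α - ρ α) * Θ (dualGen ρ Θ α (jE ϖ ^ j) h x₀))) ∧
                     Valued.v e₀ = Valued.v ϖ ^ (d % 2)) ∧
                  (∃ (x₀ : M) (r e₀ e' : E), x₀ ≠ 0 ∧ (∀ x, x ∈ Λ ↔ ∃ ζ, IsOrd ρ α (jE ϖ ^ j) ζ ∧ x = x₀ * ζ) ∧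
                     IsOrd ρ α (jE ϖ ^ j) (dualGen ρ Θ α (jE ϖ ^ j) h x₀) ∧ ¬ IsOrd ρ α (jE ϖ ^ j) (dualGen ρ Θ α (jE ϖ ^ j) h x₀ / jE ϖ) ∧
                     Valued.v (dualGen ρ Θ α (jE ϖ ^ j) h x₀) = Valued.v (jE ϖ) ^ b ∧
                     σ r = r ∧ Valued.v r = 1 ∧ jE r = glueUnit ρ Θ α (jE ϖ ^ j) h (jE ϖ) (jE hW) x₀ b ∧
                     jE e₀ = (lam - jE ((u : Matrix (Fin 1) (Fin 1) E) 0 0)) / (jE ϖ ^ j * (α - ρ α) * Θ (dualGen ρ Θ α (jE ϖ ^ j) h x₀)) +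
                       ρ ((lam - jE ((u : Matrix (Fin 1) (Fin 1) E) 0 0)) / (jE ϖ ^ j * (α - ρ α) * Θ (dualGen ρ Θ α (jE ϖ ^ j) h x₀))) ∧
                     σ e' = e' ∧ Valued.v e' = 1 ∧ Valued.v (e₀ - e' * ((ϖ - σ ϖ) * ((ϖ * σ ϖ) ^ ((d - d % 2) / 2))⁻¹)) ≤ Valued.v ϖ ^ mstarOfRecord d ∧
                     ∃ c : E, c * σ c = r * e')}.ncard =
              {Λ ∈ levelSetDep ρ Θ α (jE ϖ) h j b (lam - jE ((u : Matrix (Fin 1) (Fin 1) E) 0 0)) |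
                  (∃ (x₀ : M) (e₀ : E), x₀ ≠ 0 ∧ (∀ x, x ∈ Λ ↔ ∃ ζ, IsOrd ρ α (jE ϖ ^ j) ζ ∧ x = x₀ * ζ) ∧
                     IsOrd ρ α (jE ϖ ^ j) (dualGen ρ Θ α (jE ϖ ^ j) h x₀) ∧ ¬ IsOrd ρ α (jE ϖ ^ j) (dualGen ρ Θ α (jE ϖ ^ j) h x₀ / jE ϖ) ∧
                     Valued.v (dualGen ρ Θ α (jE ϖ ^ j) h x₀) = Valued.v (jE ϖ) ^ b ∧
                     jE e₀ = (lam - jE ((u : Matrix (Fin 1) (Fin 1) E) 0 0)) / (jE ϖ ^ j * (α - ρ α) * Θ (dualGen ρ Θ α (jE ϖ ^ j) h x₀)) +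
                       ρ ((lam - jE ((u : Matrix (Fin 1) (Fin 1) E) 0 0)) / (jE ϖ ^ j * (α - ρ α) * Θ (dualGen ρ Θ α (jE ϖ ^ j) h x₀))) ∧
                     Valued.v e₀ = Valued.v ϖ ^ (d % 2)) ∧
                  ¬ (∃ (x₀ : M) (r e₀ e' : E), x₀ ≠ 0 ∧ (∀ x, x ∈ Λ ↔ ∃ ζ, IsOrd ρ α (jE ϖ ^ j) ζ ∧ x = x₀ * ζ) ∧
                       IsOrd ρ α (jE ϖ ^ j) (dualGen ρ Θ α (jE ϖ ^ j) h x₀) ∧ ¬ IsOrd ρ α (jE ϖ ^ j) (dualGen ρ Θ α (jE ϖ ^ j) h x₀ / jE ϖ) ∧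
                       Valued.v (dualGen ρ Θ α (jE ϖ ^ j) h x₀) = Valued.v (jE ϖ) ^ b ∧
                       σ r = r ∧ Valued.v r = 1 ∧ jE r = glueUnit ρ Θ α (jE ϖ ^ j) h (jE ϖ) (jE hW) x₀ b ∧
                       jE e₀ = (lam - jE ((u : Matrix (Fin 1) (Fin 1) E) 0 0)) / (jE ϖ ^ j * (α - ρ α) * Θ (dualGen ρ Θ α (jE ϖ ^ j) h x₀)) +
                         ρ ((lam - jE ((u : Matrix (Fin 1) (Fin 1) E) 0 0)) / (jE ϖ ^ j * (α - ρ α) * Θ (dualGen ρ Θ α (jE ϖ ^ j) h x₀))) ∧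
                       σ e' = e' ∧ Valued.v e' = 1 ∧ Valued.v (e₀ - e' * ((ϖ - σ ϖ) * ((ϖ * σ ϖ) ^ ((d - d % 2) / 2))⁻¹)) ≤ Valued.v ϖ ^ mstarOfRecord d ∧
                       ∃ c : E, c * σ c = r * e')}.ncard := by
  intro E M _ _ _ _ _ _ _ _ _ _ σ ϖ d tE _hD _hσσ _h2 jE ρ Θ α lam _hρρ _hvρ _hρj _hjv _hjfix _hΘj _hΘΘ _hΘρ _hvΘ _hα _hα1 _hint _hΘlam _hvlam _hbasis _hU _hτ
    _hσres _hres _hΘne _hDM _hjiso _hq _hjpow _hEval _hϖmax γ₂ u _hdet _htr _hirr _hlam2 _hρlam m jl _hm _hjl _hs _hp _hNm _hu1N _hlam1 _hu _hum H₂ hW _hH₂ _hH₂σ _hhW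
    _hhWσ P₁ _hA _hΓ φ h _hφs _hφi _hφo _hφγ _hform _hΘh _hh J R f _hfinF _hR _hJ _hfinLS _hf j b _hb1 _hbj _h2bm _hline _hlow _hmix _hlamj
    Vf n Rd hRd1 hRd2 hRd3 LIT hgen hV hLit hF α₁ γ₁ ℓ s₀ hσα₁ hσγ₁ hrad hNXd hPcd hbase
  obtain ⟨-, -, hϖ, -, -, hd1, -⟩ := id _hD
  have hϖlt : Valued.v ϖ < 1 := by rw [hϖ, ← exp_zero, exp_lt_exp]; norm_num
  have hvϖ0 : Valued.v ϖ ≠ 0 := by rw [hϖ]; exact exp_ne_zero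
  -- the digit radii from `hrad`: `|γ₁|·|ϖ|^n ≤ |ϖ|^{2ℓ}·|ϖ|^{2d−1} < |ϖ|^{2ℓ}`
  have h2d1 : Valued.v ϖ ^ (2 * d - 1) < 1 := pow_lt_one₀ zero_le hϖlt (by omega)
  have hball : ∀ Ve V₀ : E, Valued.v (Ve - V₀) ≤ Valued.v ϖ ^ n →
      Valued.v (γ₁ * (Ve - V₀)) ≤ Valued.v ϖ ^ (2 * ℓ) * Valued.v ϖ ^ (2 * d - 1) ∧ Valued.v (γ₁ * (Ve - V₀)) < Valued.v ϖ ^ (2 * ℓ) := by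
    intro Ve V₀ hle
    have h1 : Valued.v (γ₁ * (Ve - V₀)) ≤ Valued.v ϖ ^ (2 * ℓ) * Valued.v ϖ ^ (2 * d - 1) := by rw [Valuation.map_mul]; exact (mul_le_mul' le_rfl hle).trans hrad
    refine ⟨h1, h1.trans_lt ?_⟩
    have hpos : (0 : ℤᵐ⁰) < Valued.v ϖ ^ (2 * ℓ) := zero_lt_iff.2 (pow_ne_zero _ hvϖ0)
    calc Valued.v ϖ ^ (2 * ℓ) * Valued.v ϖ ^ (2 * d - 1) < Valued.v ϖ ^ (2 * ℓ) * 1 := mul_lt_mul_of_pos_left h2d1 hpos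
      _ = Valued.v ϖ ^ (2 * ℓ) := mul_one _
  -- the bookkeeping `{Λ ∈ levelSetDep ∣ Q Λ} = {Λ ∣ (∃ x₀, GEN6 Λ x₀) ∧ Q Λ}`
  have hset : ∀ Q : AddSubgroup M → Prop,
      {Λ | Λ ∈ levelSetDep ρ Θ α (jE ϖ) h j b (lam - jE ((u : Matrix (Fin 1) (Fin 1) E) 0 0)) ∧ Q Λ} =
        {Λ : AddSubgroup M | (∃ x₀ : M,
          (x₀ ≠ 0 ∧ (∀ x, x ∈ Λ ↔ ∃ ζ, IsOrd ρ α (jE ϖ ^ j) ζ ∧ x = x₀ * ζ) ∧ IsOrd ρ α (jE ϖ ^ j) (dualGen ρ Θ α (jE ϖ ^ j) h x₀) ∧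
                  ¬ IsOrd ρ α (jE ϖ ^ j) (dualGen ρ Θ α (jE ϖ ^ j) h x₀ / jE ϖ) ∧ Valued.v (dualGen ρ Θ α (jE ϖ ^ j) h x₀) = Valued.v (jE ϖ) ^ b ∧
                  (∀ b', (∀ x ∈ Λ, Valued.v (h * Θ x * b' + ρ (h * Θ x * b')) ≤ 1) → (lam - jE ((u : Matrix (Fin 1) (Fin 1) E) 0 0)) * b' ∈ Λ))) ∧ Q Λ} := by
    intro Q; ext Λ; simp only [Set.mem_setOf_eq, mem_levelSetDep_iff, mem_levelSet_iff]; constructor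
    · rintro ⟨⟨⟨x₀, hx₀, hΛx, hyO, hyp, hylev⟩, hdep⟩, hQ⟩; exact ⟨⟨x₀, hx₀, hΛx, hyO, hyp, hylev, hdep⟩, hQ⟩
    · rintro ⟨⟨x₀, hx₀, hΛx, hyO, hyp, hylev, hdep⟩, hQ⟩; exact ⟨⟨⟨x₀, hx₀, hΛx, hyO, hyp, hylev⟩, hdep⟩, hQ⟩
  rw [hset, hset]
  -- `hbase` in §1's conjunction form
  have hbase' : ((Rd.filter LIT).filter fun V => Valued.v (α₁ + γ₁ * V) = Valued.v ϖ ^ (2 * ℓ) ∧ normSign σ (α₁ + γ₁ * V) = s₀).card =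
      ((Rd.filter LIT).filter fun V => Valued.v (α₁ + γ₁ * V) = Valued.v ϖ ^ (2 * ℓ) ∧ ¬ normSign σ (α₁ + γ₁ * V) = s₀).card := by
    rw [← Finset.filter_filter, ← Finset.filter_filter]; exact hbase
  -- §1
  refine ncard_sep_eq_ncard_sep_of_digit_reads (X := AddSubgroup M) _ Vf jE _hjiso (Valued.v ϖ ^ n) Rd hRd2 hRd3 LIT (fun V => Valued.v (α₁ + γ₁ * V) = Valued.v ϖ ^ (2 * ℓ)) (fun V => normSign σ (α₁ + γ₁ * V) = s₀)
    hgen hV hLit (fun Ve V₀ _ _ _ h4 => valueSphere_iff_of_near (hball Ve V₀ h4).2) (fun Ve V₀ hσVe _ hV₀R h4 hsph => ?_) hF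
    ((_hfinLS j b).subset fun Λ hΛ => ?_) _ _ hNXd hPcd hbase'
  · rw [normSign_affine_eq_of_near _hD hσα₁ hσγ₁ hσVe (hRd1 V₀ hV₀R).1 hsph (hball Ve V₀ h4).1]
  · obtain ⟨x₀, hx₀, hΛx, hyO, hyp, hylev, -⟩ := hΛ
    exact (mem_levelSet_iff ρ Θ α (jE ϖ) h j b Λ).2 ⟨x₀, hx₀, hΛx, hyO, hyp, hylev⟩

end Summit.HodgeConjecture.HodgeConjecture.Cruxes.H413.F0P3cDyRamMixBandProdBalanceOfFibres

end
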